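import Summits.CriticalPhenomena.PercolationContinuityZ3.Theorems.PinholeClosing.Negative.PinholeClosingResistance
import Literature.Probability.Percolation.SiteConnectionTools

/-!
# Triage scratch (crux-triage r1-2, gen 2; stmt-CriticalPhenomena-5249): the `TilingLemma` SHAPE of cards
`halfspace-polarisation` / `front-blocking-suffices` is false AS TYPED — for EVERY choice of tile grid

Ideator 3's `Sketch.lean` is not in the tree, so `frontCrossed` and `budgetEvent` below are DEFINITIONAL COPIES
of the definitions displayed on the two cards (`budgetEvent n k m` = the route's inlined budget-`k` event of
`box n → ∂ⁱⁿ box m`; `frontCrossed i σ z n L` verbatim).  The cards' first lemma reads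
`TilingLemma : ∀ n l, 1 ≤ n → 2 ≤ l → ∀ ω, (∀ i σ, (σ = 1 ∨ σ = -1) → ∀ z ∈ tileGrid i σ n (l*n),
ω ∉ frontCrossed i σ z n (l*n)) → ω ∈ budgetEvent n 0 (2*l*n)`; here `tileGrid` is an ARBITRARY parameter
(`TilingLemmaShape tileGrid`), and the refutation does not depend on it: with `n = 1, l = 2` the single
NON-lattice pair `jump = {s((0,0,0), (4,0,0))}` is "open" for `openGraph = SimpleGraph.fromEdgeSet`, crosses
`box 1 → ∂ⁱⁿ box 4` in one step, and is a front-confined crossing of NO translate `z + A(1,2)` whatsoever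
(an endpoint in `z + box 1` forces the other endpoint out of `z + box 2`).  This is triager 1's
CROSS-CUTTING DEFECT (`NotTransitLemmaAsTyped-triage1.lean`, `NotFlatLandscapeExclusionAsTyped-triage1.lean`)
for the third family of deterministic stubs.  REPAIR (one token, planner/lead): prefix `ω ⊆ (zdGraph 3).edgeSet →`
(true a.s.: `Negative.ae_subset`); the probabilistic corollaries (`TilingCorollary`, the k = 0 rung) are unaffected.
-/

open Literature.Probability.Percolation Literature.Probability.LatticeModels
open Summit.CriticalPhenomena.PercolationContinuityZ3.Theorems.PinholeClosing.Negative

namespace TriageR1K2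

/-- Definitional copy of ideator 3's `frontCrossed` (card halfspace-polarisation, First lemma). -/
def frontCrossed (i : Fin 3) (σ : ℤ) (z : Site 3) (n L : ℕ) : Set (BondConfig (Site 3)) :=
  {ω | ∃ x ∈ (box 3 n).image (· + z), ∃ y ∈ (innerBoundary (zdGraph 3) (box 3 L)).image (· + z),
    ω ∈ openConnIn {v | v - z ∈ box 3 L ∧ 0 ≤ σ * (v i - z i)} x y}

/-- Definitional copy of ideator 3's `budgetEvent n k m` (the route's inlined budget-`k` blocked event). -/
def budgetEvent (n k m : ℕ) : Set (BondConfig (Site 3)) :=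
  {ω | ∃ S : Finset (Sym2 (Site 3)), S.card ≤ k ∧ ¬ ∃ x ∈ box 3 n,
    ∃ y ∈ innerBoundary (zdGraph 3) (box 3 m), (ω \ ↑S) ∈ openConnIn ↑(box 3 m) x y}

/-- The typed shape of `TilingLemma`, for an arbitrary tile grid. -/
def TilingLemmaShape (tileGrid : Fin 3 → ℤ → ℕ → ℕ → Set (Site 3)) : Prop :=
  ∀ n l : ℕ, 1 ≤ n → 2 ≤ l → ∀ ω : BondConfig (Site 3),
    (∀ (i : Fin 3) (σ : ℤ), (σ = 1 ∨ σ = -1) → ∀ z ∈ tileGrid i σ n (l * n),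
      ω ∉ frontCrossed i σ z n (l * n)) →
    ω ∈ budgetEvent n 0 (2 * l * n)

/-- The lattice point `(i, 0, 0)`. -/
def pt (i : ℕ) : Site 3 := Pi.single 0 (i : ℤ)

@[simp] theorem pt_apply_zero (i : ℕ) : pt i 0 = i := by simp [pt]

theorem pt_apply_ne {j : Fin 3} (hj : j ≠ 0) (i : ℕ) : pt i j = 0 := by simp [pt, hj]

theorem pt_mem_box {i m : ℕ} (h : i ≤ m) : pt i ∈ box 3 m := by
  rw [mem_box]
  intro j
  by_cases hj : j = 0
  · subst hj; simp only [pt_apply_zero]; omega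
  · simp only [pt_apply_ne hj]; omega

theorem le_of_pt_mem_box {i n : ℕ} (h : pt i ∈ box 3 n) : i ≤ n := by
  rw [mem_box] at h
  have := (h 0).2
  simp only [pt_apply_zero] at this
  exact_mod_cast this

theorem pt_succ_eq (i : ℕ) : pt (i + 1) = pt i + Pi.single 0 1 := by
  simp [pt, Nat.cast_succ, Pi.single_add]

theorem pt_mem_innerBoundary (m : ℕ) : pt m ∈ innerBoundary (zdGraph 3) (box 3 m) := by
  rw [mem_innerBoundary_iff]
  refine ⟨pt_mem_box le_rfl, pt (m + 1), fun h => ?_, ?_⟩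
  · have := le_of_pt_mem_box h; omega
  · rw [zdGraph_adj_iff]; exact ⟨0, Or.inl (pt_succ_eq m)⟩

/-- The jump configuration: the single NON-lattice pair `{(0,0,0), (4,0,0)}` declared open. -/
def jump : BondConfig (Site 3) := {s(pt 0, pt 4)}

theorem pt0_ne_pt4 : pt 0 ≠ pt 4 := by
  intro h
  have := congrArg (fun x : Site 3 => x 0) h
  simp at this

/-- The jump crosses `box 1 → ∂ⁱⁿ box 4` inside `box 4`, so `budgetEvent 1 0 4` fails. -/
theorem jump_notMem_budgetEvent : jump ∉ budgetEvent 1 0 (2 * 2 * 1) := by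
  rintro ⟨S, hS, hnot⟩
  have hS0 : S = ∅ := Finset.card_eq_zero.mp (Nat.le_zero.mp hS)
  subst hS0
  apply hnot
  refine ⟨pt 0, pt_mem_box (by norm_num), pt 4, pt_mem_innerBoundary 4, ?_⟩
  refine ⟨Finset.mem_coe.2 (pt_mem_box (by norm_num)), Finset.mem_coe.2 (pt_mem_box le_rfl), ?_⟩
  refine SimpleGraph.Adj.reachable ?_
  simp only [SimpleGraph.induce_adj, openGraph_adj, Finset.coe_empty, Set.sdiff_empty]
  exact ⟨by simp [jump], pt0_ne_pt4⟩

/-- No translate `z + A(1, 2)` — grid point or not, for any axis and sign — has a front-confined crossing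
in the jump configuration (indeed no open step starts in `z + box 1` and stays in `z + box 2`). -/
theorem jump_notMem_frontCrossed (i : Fin 3) (σ : ℤ) (z : Site 3) :
    jump ∉ frontCrossed i σ z 1 (2 * 1) := by
  rintro ⟨x, hx, y, hy, hxF, hyF, hr⟩
  obtain ⟨a, ha, hax⟩ := Finset.mem_image.1 hx
  obtain ⟨b, hb, hby⟩ := Finset.mem_image.1 hy
  obtain ⟨w⟩ := hr
  cases w with
  | nil =>
    -- x = y: then a = b lies in box 1 and on ∂ⁱⁿ box 2
    have hab : a = b := add_right_cancel (hax.trans hby.symm)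
    subst hab
    exact absurd ha (notMem_box_of_mem_innerBoundary (by norm_num) hb)
  | cons hadj p =>
    rename_i c
    simp only [SimpleGraph.induce_adj, openGraph_adj] at hadj
    obtain ⟨hmem, -⟩ := hadj
    simp only [jump, Set.mem_singleton_iff, Sym2.eq_iff] at hmem
    have hcF := c.2
    simp only [Set.mem_setOf_eq] at hcF
    obtain ⟨hcbox, -⟩ := hcF
    rw [mem_box] at ha hcbox
    have ha0 := ha 0
    have hc0 := hcbox 0
    have hx0 : a 0 + z 0 = x 0 := by rw [← hax]; rfl
    simp only [Pi.sub_apply] at hc0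
    rcases hmem with ⟨h1, h2⟩ | ⟨h1, h2⟩
    · -- x = pt 0, c = pt 4: z 0 ≤ 1 from a, but 4 - z 0 ≤ 2 from c
      rw [h1, pt_apply_zero] at hx0
      rw [h2, pt_apply_zero] at hc0
      push_cast at hx0 hc0
      omega
    · -- x = pt 4, c = pt 0: z 0 ≥ 3 from a, but -2 ≤ 0 - z 0 from c
      rw [h1, pt_apply_zero] at hx0
      rw [h2, pt_apply_zero] at hc0
      push_cast at hx0 hc0
      omega

/-- **The `TilingLemma` shape (cards halfspace-polarisation / front-blocking-suffices) is false as typed,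
whatever the tile grid.**  Witness `n = 1, l = 2`, the jump configuration. -/
theorem not_tilingLemmaShape (tileGrid : Fin 3 → ℤ → ℕ → ℕ → Set (Site 3)) :
    ¬ TilingLemmaShape tileGrid := by
  intro h
  exact jump_notMem_budgetEvent
    (h 1 2 le_rfl le_rfl jump (fun i σ _ z _ => jump_notMem_frontCrossed i σ z))

end TriageR1K2
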